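/-
Copyright: the b2b-balaban T⁴-continuum CRUX team, row NE7b OWNER lineage `t4-ne7b-p1` (gen 139). Project licence.
-/
import Mathlib.MeasureTheory.Function.L2Space
import Mathlib.Probability.Moments.Variance
import Mathlib.MeasureTheory.Constructions.BorelSpace.Real

/-!
# THE COORDINATE-LIPSCHITZ CLASS — the observables of Dobrushin's covariance estimate (SCOPING (d10)(2)): a function `F` on `ℝ^ι` with
# COORDINATE-LIPSCHITZ VECTOR `a` (`|F(ω^{z,s}) − F(ω^{z,t})| ≤ a_z|s − t|`, `ω^{z,s} = Function.update ω z s`; Föllmer's `δ_z(F) ≤ a_z`)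
# telescopes (`|F(ω) − F(ω′)| ≤ Σ_z a_z|ω_z − ω′_z|`), grows linearly, is Lipschitz hence continuous hence measurable, is square integrable
# under any probability law with second moments, and two members `F, G` (vectors `a, b`) have
#   `|Cov_μ(F,G)| ≤ 2M₂·(Σ_za_z)(Σ_zb_z)`   (`∫ω_z² dμ ≤ M₂` for all `z`)
# — the remainder of the Gibbs-sampler telescoping, which (440)'s sweep contraction sends to zero
# (row NE7b, node U5c; Mathlib only; [folklore])

Cell `pub-balaban`, sub-cell `t4`, spine estimate NE7b (`T4WeightBudget.RelWeightBound`; the cell's OWN estimate — NOT PRINTED in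
[Bałaban 1983–89], NOT PROVED).  Crux-route work under `Spine/NE7b/` by the row OWNER (`t4-ne7b-p1` gen 139, file (441)) under FREEZE
(0)'s crux-prover clause; NOTHING of Bałaban's is named as a Lean object, valued or asserted; no `T4Continuum/Support` leaf typed; no
`def`, no notation (the class is a written-out hypothesis `hF`); zero `sorry`.  Imports: Mathlib only (fast lane).

WHY (located, SCOPING-d10 (2)).  Dobrushin's method ((440)) transports the vector of coordinate oscillations of an observable along the
single-site Gibbs sampler.  This file fixes the class on which the sampler acts and proves the facts the abstract assembly (442) needs:
the class is stable under what the sampler does to it (that is (444)), its members are integrable against the laws in play, and the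
covariance of two members is controlled by the total masses of their vectors — so a vanishing total mass kills the covariance.

WHAT IS PROVED ([folklore]; `F G : (ι → ℝ) → ℝ`, `a b : ι → ℝ`, class hypothesis `∀ z ω s t, |F(update ω z s) − F(update ω z t)| ≤ a_z|s−t|`):
* §1 `lipVec_nonneg` (`0 ≤ a_z`), **`abs_sub_le_sum`** (`|F ω − F ω′| ≤ Σ_z a_z|ω_z − ω′_z|`, by `Finset.piecewise` telescoping),
  `abs_le_linear` (`|F ω| ≤ |F 0| + Σ_z a_z|ω_z|`), `lipschitzWith` (constant `Σ_za_z` for the sup distance), `continuous`, `measurable`;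
  class algebra: `lipVec_const`, `lipVec_coord` (`ω ↦ ω_z`: vector `e_z`), `lipVec_add`, `lipVec_smul`, `lipVec_mono`.
* §2 under a probability law `μ` on `ℝ^ι` with `ω_z ∈ L²(μ)`: `memLp_two`, `integrable`, `integrable_mul`, `integrable_sq`.
* §3 **`abs_cov_le`**: `|∫FG dμ − ∫F dμ·∫G dμ| ≤ 2M₂(Σ_za_z)(Σ_zb_z)` when `∫ω_z² dμ ≤ M₂` for all `z`.
* §4 toy (kernel): `F(ω) = ω_0` on `Fin 1 → ℝ` has vector `a = 1`.

HONEST (what this is NOT).  Bookkeeping of a function class; the sampler, its invariance and the covariance estimate are (442)–(446); the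
road instance (447).  Scalar skeleton ((A3), NC-NE7b-α UNRULED); nothing of Bałaban's asserted.  BY-NAME EFFECT ON THE WALL: NONE.  NE7b NOT
PRINTED ∕ NOT PROVED; spine PROVED 0∕9; rung (B)+1 — the programme's measures remain FINITE-torus statements; NOT the mass gap, NOT Clay.
HONEST DEPENDENCY: continuum YM on T⁴ ⇐ BetaPertH ∧ nine spine estimates (0∕9 proved); BetaPertH ⇐ (D1) ∧ (D4) ∧ CAP+tail; G-an2-4 gates
asym, D1 and NE2∕3∕4.
-/

set_option autoImplicit false

noncomputable section

namespace Summit.QuantumFields.BalabanUV.T4Continuum.NE7b.SupCoordinateLipschitzClass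

open MeasureTheory ProbabilityTheory Finset Function
open scoped BigOperators NNReal

variable {ι : Type} [Fintype ι] [DecidableEq ι]

variable {F G : (ι → ℝ) → ℝ} {a b : ι → ℝ}

/-! ## §1. Telescoping, growth, continuity; class algebra -/

omit [Fintype ι] in
/-- A coordinate-Lipschitz vector is nonnegative. [folklore] -/
theorem lipVec_nonneg (hF : ∀ z ω s t, |F (update ω z s) - F (update ω z t)| ≤ a z * |s - t|) (z : ι) : 0 ≤ a z := by
  rcases isEmpty_or_nonempty (ι → ℝ) with h | ⟨⟨ω⟩⟩
  · exact (h.false (fun _ => 0)).elim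
  · have h := hF z ω 1 0
    rw [sub_zero, abs_one, mul_one] at h
    exact (abs_nonneg _).trans h

/-- **TELESCOPING**: `|F ω − F ω′| ≤ Σ_z a_z|ω_z − ω′_z|` (change the coordinates one at a time along `Finset.piecewise`). [folklore] -/
theorem abs_sub_le_sum (hF : ∀ z ω s t, |F (update ω z s) - F (update ω z t)| ≤ a z * |s - t|) (ω ω' : ι → ℝ) :
    |F ω - F ω'| ≤ ∑ z, a z * |ω z - ω' z| := by
  -- `|F(s.piecewise ω ω') − F ω'| ≤ Σ_{z∈s} a_z|ω_z − ω'_z|` for every finset `s`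
  suffices h : ∀ s : Finset ι, |F (s.piecewise ω ω') - F ω'| ≤ ∑ z ∈ s, a z * |ω z - ω' z| by
    simpa only [Finset.piecewise_univ] using h Finset.univ
  intro s
  induction s using Finset.induction_on with
  | empty => simp
  | insert z s hz ih =>
    rw [Finset.piecewise_insert, Finset.sum_insert hz]
    have hstep : |F (update (s.piecewise ω ω') z (ω z)) - F (s.piecewise ω ω')| ≤ a z * |ω z - ω' z| := by
      have h := hF z (s.piecewise ω ω') (ω z) (ω' z)
      have e : update (s.piecewise ω ω') z (ω' z) = s.piecewise ω ω' := by
        have hp : s.piecewise ω ω' z = ω' z := Finset.piecewise_eq_of_notMem s ω ω' hz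
        rw [← hp, update_eq_self]
      rwa [e] at h
    calc |F (update (s.piecewise ω ω') z (ω z)) - F ω'|
        = |(F (update (s.piecewise ω ω') z (ω z)) - F (s.piecewise ω ω')) + (F (s.piecewise ω ω') - F ω')| := by ring_nf
      _ ≤ |F (update (s.piecewise ω ω') z (ω z)) - F (s.piecewise ω ω')| + |F (s.piecewise ω ω') - F ω'| := abs_add_le _ _
      _ ≤ a z * |ω z - ω' z| + ∑ z ∈ s, a z * |ω z - ω' z| := add_le_add hstep ih

/-- **LINEAR GROWTH**: `|F ω| ≤ |F 0| + Σ_z a_z|ω_z|`. [folklore] -/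
theorem abs_le_linear (hF : ∀ z ω s t, |F (update ω z s) - F (update ω z t)| ≤ a z * |s - t|) (ω : ι → ℝ) :
    |F ω| ≤ |F 0| + ∑ z, a z * |ω z| := by
  have h := abs_sub_le_sum hF ω 0
  simp only [Pi.zero_apply, sub_zero] at h
  have : |F ω| ≤ |F ω - F 0| + |F 0| := by
    have := abs_add_le (F ω - F 0) (F 0); rwa [sub_add_cancel] at this
  linarith

/-- **LIPSCHITZ for the sup distance** with constant `Σ_z a_z`. [folklore] -/
theorem lipschitzWith (hF : ∀ z ω s t, |F (update ω z s) - F (update ω z t)| ≤ a z * |s - t|) :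
    LipschitzWith (Real.toNNReal (∑ z, a z)) F := by
  have ha : 0 ≤ ∑ z, a z := Finset.sum_nonneg fun z _ => lipVec_nonneg hF z
  refine LipschitzWith.of_dist_le_mul fun ω ω' => ?_
  rw [Real.dist_eq, Real.coe_toNNReal _ ha, Finset.sum_mul]
  refine (abs_sub_le_sum hF ω ω').trans (Finset.sum_le_sum fun z _ => ?_)
  exact mul_le_mul_of_nonneg_left (by rw [← Real.dist_eq]; exact dist_le_pi_dist ω ω' z) (lipVec_nonneg hF z)

/-- A member of the class is continuous. [folklore] -/
theorem continuous (hF : ∀ z ω s t, |F (update ω z s) - F (update ω z t)| ≤ a z * |s - t|) : Continuous F :=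
  (lipschitzWith hF).continuous

/-- A member of the class is measurable. [folklore] -/
theorem measurable (hF : ∀ z ω s t, |F (update ω z s) - F (update ω z t)| ≤ a z * |s - t|) : Measurable F :=
  (continuous hF).measurable

omit [Fintype ι] in
/-- Constants are in the class with the zero vector. [folklore] -/
theorem lipVec_const (C : ℝ) (z : ι) (ω : ι → ℝ) (s t : ℝ) :
    |(fun _ : ι → ℝ => C) (update ω z s) - (fun _ : ι → ℝ => C) (update ω z t)| ≤ (0 : ι → ℝ) z * |s - t| := by simp

omit [Fintype ι] in
/-- The coordinate `ω ↦ ω_y` is in the class with the vector `e_y`. [folklore] -/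
theorem lipVec_coord (y z : ι) (ω : ι → ℝ) (s t : ℝ) :
    |(fun ω : ι → ℝ => ω y) (update ω z s) - (fun ω : ι → ℝ => ω y) (update ω z t)| ≤ (if z = y then (1 : ℝ) else 0) * |s - t| := by
  by_cases h : z = y
  · subst h; simp
  · simp [update_of_ne (Ne.symm h), h]

omit [Fintype ι] in
/-- The class is stable under sums (vectors add). [folklore] -/
theorem lipVec_add (hF : ∀ z ω s t, |F (update ω z s) - F (update ω z t)| ≤ a z * |s - t|)
    (hG : ∀ z ω s t, |G (update ω z s) - G (update ω z t)| ≤ b z * |s - t|) (z : ι) (ω : ι → ℝ) (s t : ℝ) :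
    |(F + G) (update ω z s) - (F + G) (update ω z t)| ≤ (a + b) z * |s - t| := by
  simp only [Pi.add_apply]
  calc |F (update ω z s) + G (update ω z s) - (F (update ω z t) + G (update ω z t))|
      = |(F (update ω z s) - F (update ω z t)) + (G (update ω z s) - G (update ω z t))| := by ring_nf
    _ ≤ |F (update ω z s) - F (update ω z t)| + |G (update ω z s) - G (update ω z t)| := abs_add_le _ _
    _ ≤ a z * |s - t| + b z * |s - t| := add_le_add (hF z ω s t) (hG z ω s t)
    _ = (a z + b z) * |s - t| := by ring

omit [Fintype ι] in
/-- The class is stable under scalars (vectors scale by `|r|`). [folklore] -/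
theorem lipVec_smul (hF : ∀ z ω s t, |F (update ω z s) - F (update ω z t)| ≤ a z * |s - t|) (r : ℝ) (z : ι) (ω : ι → ℝ)
    (s t : ℝ) : |(r • F) (update ω z s) - (r • F) (update ω z t)| ≤ (|r| • a) z * |s - t| := by
  simp only [Pi.smul_apply, smul_eq_mul]
  rw [← mul_sub, abs_mul, mul_assoc]
  exact mul_le_mul_of_nonneg_left (hF z ω s t) (abs_nonneg r)

omit [Fintype ι] in
/-- A larger vector also works. [folklore] -/
theorem lipVec_mono (hF : ∀ z ω s t, |F (update ω z s) - F (update ω z t)| ≤ a z * |s - t|) (hab : ∀ z, a z ≤ b z) (z : ι)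
    (ω : ι → ℝ) (s t : ℝ) : |F (update ω z s) - F (update ω z t)| ≤ b z * |s - t| :=
  (hF z ω s t).trans (mul_le_mul_of_nonneg_right (hab z) (abs_nonneg _))

/-! ## §2. Integrability under a law with second moments -/

section Measure

variable {μ : Measure (ι → ℝ)} [IsProbabilityMeasure μ] {M₂ : ℝ}

omit [DecidableEq ι] in
/-- The linear envelope `|F 0| + Σ_z a_z|ω_z|` is square integrable. [folklore] -/
theorem memLp_envelope (hμ2 : ∀ z, MemLp (fun ω : ι → ℝ => ω z) 2 μ) (C : ℝ) (a : ι → ℝ) :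
    MemLp (fun ω : ι → ℝ => C + ∑ z, a z * |ω z|) 2 μ := by
  have h1 : MemLp (fun _ : ι → ℝ => C) 2 μ := memLp_const C
  have h2 : MemLp (fun ω : ι → ℝ => ∑ z, a z * |ω z|) 2 μ :=
    memLp_finsetSum _ fun z _ => ((hμ2 z).norm.const_mul (a z))
  exact h1.add h2

/-- **A member of the class is square integrable** under a probability law with second moments. [folklore] -/
theorem memLp_two (hF : ∀ z ω s t, |F (update ω z s) - F (update ω z t)| ≤ a z * |s - t|)
    (hμ2 : ∀ z, MemLp (fun ω : ι → ℝ => ω z) 2 μ) : MemLp F 2 μ := by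
  refine (memLp_envelope hμ2 (|F 0|) a).mono' (measurable hF).aestronglyMeasurable (ae_of_all _ fun ω => ?_)
  rw [Real.norm_eq_abs]
  exact abs_le_linear hF ω

/-- A member of the class is integrable. [folklore] -/
theorem integrable (hF : ∀ z ω s t, |F (update ω z s) - F (update ω z t)| ≤ a z * |s - t|)
    (hμ2 : ∀ z, MemLp (fun ω : ι → ℝ => ω z) 2 μ) : Integrable F μ :=
  (memLp_two hF hμ2).integrable one_le_two

/-- The product of two members is integrable. [folklore] -/
theorem integrable_mul (hF : ∀ z ω s t, |F (update ω z s) - F (update ω z t)| ≤ a z * |s - t|)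
    (hG : ∀ z ω s t, |G (update ω z s) - G (update ω z t)| ≤ b z * |s - t|) (hμ2 : ∀ z, MemLp (fun ω : ι → ℝ => ω z) 2 μ) :
    Integrable (fun ω => F ω * G ω) μ :=
  (memLp_two hF hμ2).integrable_mul (memLp_two hG hμ2)

/-- The square of a member is integrable. [folklore] -/
theorem integrable_sq (hF : ∀ z ω s t, |F (update ω z s) - F (update ω z t)| ≤ a z * |s - t|)
    (hμ2 : ∀ z, MemLp (fun ω : ι → ℝ => ω z) 2 μ) : Integrable (fun ω => F ω ^ 2) μ :=
  (memLp_two hF hμ2).integrable_sq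

/-! ## §3. The covariance of two members against the total masses -/

omit [Fintype ι] [DecidableEq ι] [IsProbabilityMeasure μ] in
/-- Second moments dominate mixed first absolute moments: `∫|ω_z||ω_y| ≤ M₂`. [folklore] -/
theorem integral_abs_mul_abs_le (hμ2 : ∀ z, MemLp (fun ω : ι → ℝ => ω z) 2 μ) (hM : ∀ z, ∫ ω, ω z ^ 2 ∂μ ≤ M₂) (z y : ι) :
    ∫ ω, |ω z| * |ω y| ∂μ ≤ M₂ := by
  have h2 : ∀ w, Integrable (fun ω : ι → ℝ => ω w ^ 2) μ := fun w => (hμ2 w).integrable_sq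
  calc ∫ ω, |ω z| * |ω y| ∂μ ≤ ∫ ω, (ω z ^ 2 + ω y ^ 2) / 2 ∂μ := by
        refine integral_mono_of_nonneg (ae_of_all _ fun ω => mul_nonneg (abs_nonneg _) (abs_nonneg _)) (((h2 z).add (h2 y)).div_const 2)
          (ae_of_all _ fun ω => ?_)
        have := two_mul_le_add_sq (|ω z|) (|ω y|)
        rw [sq_abs, sq_abs] at this
        simp only
        linarith
    _ = ((∫ ω, ω z ^ 2 ∂μ) + ∫ ω, ω y ^ 2 ∂μ) / 2 := by rw [integral_div, integral_add (h2 z) (h2 y)]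
    _ ≤ M₂ := by linarith [hM z, hM y]

omit [Fintype ι] [DecidableEq ι] in
/-- First absolute moments: `(∫|ω_z|)(∫|ω_y|) ≤ M₂` (Jensen + AM–GM). [folklore] -/
theorem integral_abs_mul_integral_abs_le (hμ2 : ∀ z, MemLp (fun ω : ι → ℝ => ω z) 2 μ) (hM : ∀ z, ∫ ω, ω z ^ 2 ∂μ ≤ M₂) (z y : ι) :
    (∫ ω, |ω z| ∂μ) * (∫ ω, |ω y| ∂μ) ≤ M₂ := by
  -- Jensen: `(∫|ω_w|)² ≤ ∫ω_w²` via the nonnegativity of the variance of `|ω_w|`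
  have hJ : ∀ w, (∫ ω, |ω w| ∂μ) ^ 2 ≤ ∫ ω, ω w ^ 2 ∂μ := by
    intro w
    have hm : MemLp (fun ω : ι → ℝ => |ω w|) 2 μ := (hμ2 w).abs
    have hv := variance_nonneg (fun ω : ι → ℝ => |ω w|) μ
    rw [variance_eq_sub hm] at hv
    have e : ∫ ω, ((fun ω : ι → ℝ => |ω w|) ^ 2) ω ∂μ = ∫ ω, ω w ^ 2 ∂μ := integral_congr_ae (ae_of_all _ fun ω => by simp)
    rw [e] at hv
    linarith
  have := two_mul_le_add_sq (∫ ω, |ω z| ∂μ) (∫ ω, |ω y| ∂μ)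
  linarith [hJ z, hJ y, hM z, hM y]

/-- **THE COVARIANCE OF TWO MEMBERS AGAINST THE TOTAL MASSES**: `|∫FG − ∫F∫G| ≤ 2M₂·(Σ_za_z)(Σ_zb_z)` under a probability law with
`∫ω_z² ≤ M₂` (shift `F, G` by their values at `0`, telescope both, and use the two moment bounds). [folklore] -/
theorem abs_cov_le (hF : ∀ z ω s t, |F (update ω z s) - F (update ω z t)| ≤ a z * |s - t|)
    (hG : ∀ z ω s t, |G (update ω z s) - G (update ω z t)| ≤ b z * |s - t|) (hμ2 : ∀ z, MemLp (fun ω : ι → ℝ => ω z) 2 μ)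
    (hM : ∀ z, ∫ ω, ω z ^ 2 ∂μ ≤ M₂) :
    |∫ ω, F ω * G ω ∂μ - (∫ ω, F ω ∂μ) * (∫ ω, G ω ∂μ)| ≤ 2 * M₂ * (∑ z, a z) * (∑ z, b z) := by
  have hFi := integrable hF hμ2
  have hGi := integrable hG hμ2
  have hFGi := integrable_mul hF hG hμ2
  have ha0 : ∀ z, 0 ≤ a z := lipVec_nonneg hF
  have hb0 : ∀ z, 0 ≤ b z := lipVec_nonneg hG
  -- shift by the values at `0`
  set f0 : ℝ := F 0 with hf0
  set g0 : ℝ := G 0 with hg0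
  have hf : ∀ ω, |F ω - f0| ≤ ∑ z, a z * |ω z| := fun ω => by simpa using abs_sub_le_sum hF ω 0
  have hg : ∀ ω, |G ω - g0| ≤ ∑ z, b z * |ω z| := fun ω => by simpa using abs_sub_le_sum hG ω 0
  -- the absolute-moment integrals
  have habs : ∀ z, Integrable (fun ω : ι → ℝ => |ω z|) μ := fun z => ((hμ2 z).integrable one_le_two).abs
  have hprod : ∀ z y, Integrable (fun ω : ι → ℝ => |ω z| * |ω y|) μ := fun z y => (hμ2 z).norm.integrable_mul (hμ2 y).norm
  have hcov : ∫ ω, F ω * G ω ∂μ - (∫ ω, F ω ∂μ) * (∫ ω, G ω ∂μ) =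
      ∫ ω, (F ω - f0) * (G ω - g0) ∂μ - (∫ ω, (F ω - f0) ∂μ) * (∫ ω, (G ω - g0) ∂μ) := by
    have iF : ∫ ω, (F ω - f0) ∂μ = ∫ ω, F ω ∂μ - f0 := by
      rw [integral_sub hFi (integrable_const f0), integral_const, probReal_univ, one_smul]
    have iG : ∫ ω, (G ω - g0) ∂μ = ∫ ω, G ω ∂μ - g0 := by
      rw [integral_sub hGi (integrable_const g0), integral_const, probReal_univ, one_smul]
    have hA : Integrable (fun ω => F ω * G ω - g0 * F ω) μ := hFGi.sub (hFi.const_mul g0)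
    have hB : Integrable (fun ω => F ω * G ω - g0 * F ω - f0 * G ω) μ := hA.sub (hGi.const_mul f0)
    have iFG : ∫ ω, (F ω - f0) * (G ω - g0) ∂μ = ∫ ω, F ω * G ω ∂μ - g0 * ∫ ω, F ω ∂μ - f0 * ∫ ω, G ω ∂μ + f0 * g0 := by
      have e : ∀ ω, (F ω - f0) * (G ω - g0) = (F ω * G ω - g0 * F ω - f0 * G ω) + f0 * g0 := fun ω => by ring
      simp_rw [e]
      rw [integral_add hB (integrable_const _), integral_sub hA (hGi.const_mul f0), integral_sub hFGi (hFi.const_mul g0),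
        integral_const_mul, integral_const_mul, integral_const, probReal_univ, one_smul]
    rw [iF, iG, iFG]; ring
  rw [hcov]
  -- first term
  have hpt : ∀ ω, |(F ω - f0) * (G ω - g0)| ≤ ∑ z, ∑ y, (a z * b y) * (|ω z| * |ω y|) := fun ω => by
    rw [abs_mul]
    calc |F ω - f0| * |G ω - g0| ≤ (∑ z, a z * |ω z|) * (∑ y, b y * |ω y|) :=
          mul_le_mul (hf ω) (hg ω) (abs_nonneg _) (Finset.sum_nonneg fun z _ => mul_nonneg (ha0 z) (abs_nonneg _))
      _ = ∑ z, ∑ y, (a z * b y) * (|ω z| * |ω y|) := by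
          rw [Finset.sum_mul_sum]; exact Finset.sum_congr rfl fun z _ => Finset.sum_congr rfl fun y _ => by ring
  have hint2 : Integrable (fun ω : ι → ℝ => ∑ z, ∑ y, (a z * b y) * (|ω z| * |ω y|)) μ :=
    integrable_finsetSum _ fun z _ => integrable_finsetSum _ fun y _ => (hprod z y).const_mul _
  have hsum : M₂ * (∑ z, a z) * (∑ z, b z) = ∑ z, ∑ y, (a z * b y) * M₂ := by
    calc M₂ * (∑ z, a z) * (∑ z, b z) = ((∑ z, a z) * ∑ y, b y) * M₂ := by ring
      _ = (∑ z, ∑ y, a z * b y) * M₂ := by rw [Finset.sum_mul_sum]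
      _ = ∑ z, ∑ y, (a z * b y) * M₂ := by
          rw [Finset.sum_mul]
          exact Finset.sum_congr rfl fun z _ => by rw [Finset.sum_mul]
  have h1 : |∫ ω, (F ω - f0) * (G ω - g0) ∂μ| ≤ M₂ * (∑ z, a z) * (∑ z, b z) := by
    calc |∫ ω, (F ω - f0) * (G ω - g0) ∂μ| ≤ ∫ ω, |(F ω - f0) * (G ω - g0)| ∂μ := abs_integral_le_integral_abs
      _ ≤ ∫ ω, ∑ z, ∑ y, (a z * b y) * (|ω z| * |ω y|) ∂μ :=
          integral_mono_of_nonneg (ae_of_all _ fun ω => abs_nonneg _) hint2 (ae_of_all _ hpt)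
      _ = ∑ z, ∑ y, (a z * b y) * ∫ ω, |ω z| * |ω y| ∂μ := by
          rw [integral_finsetSum _ fun z _ => integrable_finsetSum _ fun y _ => (hprod z y).const_mul _]
          refine Finset.sum_congr rfl fun z _ => ?_
          rw [integral_finsetSum _ fun y _ => (hprod z y).const_mul _]
          exact Finset.sum_congr rfl fun y _ => integral_const_mul _ _
      _ ≤ ∑ z, ∑ y, (a z * b y) * M₂ := Finset.sum_le_sum fun z _ => Finset.sum_le_sum fun y _ =>
          mul_le_mul_of_nonneg_left (integral_abs_mul_abs_le hμ2 hM z y) (mul_nonneg (ha0 z) (hb0 y))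
      _ = M₂ * (∑ z, a z) * (∑ z, b z) := hsum.symm
  -- second term
  have hF1 : |∫ ω, (F ω - f0) ∂μ| ≤ ∑ z, a z * ∫ ω, |ω z| ∂μ := by
    calc |∫ ω, (F ω - f0) ∂μ| ≤ ∫ ω, |F ω - f0| ∂μ := abs_integral_le_integral_abs
      _ ≤ ∫ ω, ∑ z, a z * |ω z| ∂μ := integral_mono_of_nonneg (ae_of_all _ fun ω => abs_nonneg _)
          (integrable_finsetSum _ fun z _ => (habs z).const_mul _) (ae_of_all _ hf)
      _ = ∑ z, a z * ∫ ω, |ω z| ∂μ := by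
          rw [integral_finsetSum _ fun z _ => (habs z).const_mul _]
          exact Finset.sum_congr rfl fun z _ => integral_const_mul _ _
  have hG1 : |∫ ω, (G ω - g0) ∂μ| ≤ ∑ z, b z * ∫ ω, |ω z| ∂μ := by
    calc |∫ ω, (G ω - g0) ∂μ| ≤ ∫ ω, |G ω - g0| ∂μ := abs_integral_le_integral_abs
      _ ≤ ∫ ω, ∑ z, b z * |ω z| ∂μ := integral_mono_of_nonneg (ae_of_all _ fun ω => abs_nonneg _)
          (integrable_finsetSum _ fun z _ => (habs z).const_mul _) (ae_of_all _ hg)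
      _ = ∑ z, b z * ∫ ω, |ω z| ∂μ := by
          rw [integral_finsetSum _ fun z _ => (habs z).const_mul _]
          exact Finset.sum_congr rfl fun z _ => integral_const_mul _ _
  have hI0 : ∀ z, 0 ≤ ∫ ω, |ω z| ∂μ := fun z => integral_nonneg fun ω => abs_nonneg _
  have h2 : |(∫ ω, (F ω - f0) ∂μ) * (∫ ω, (G ω - g0) ∂μ)| ≤ M₂ * (∑ z, a z) * (∑ z, b z) := by
    rw [abs_mul]
    calc |∫ ω, (F ω - f0) ∂μ| * |∫ ω, (G ω - g0) ∂μ| ≤ (∑ z, a z * ∫ ω, |ω z| ∂μ) * (∑ z, b z * ∫ ω, |ω z| ∂μ) :=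
          mul_le_mul hF1 hG1 (abs_nonneg _) (Finset.sum_nonneg fun z _ => mul_nonneg (ha0 z) (hI0 z))
      _ = ∑ z, ∑ y, (a z * b y) * ((∫ ω, |ω z| ∂μ) * ∫ ω, |ω y| ∂μ) := by
          rw [Finset.sum_mul_sum]
          exact Finset.sum_congr rfl fun z _ => Finset.sum_congr rfl fun y _ => by ring
      _ ≤ ∑ z, ∑ y, (a z * b y) * M₂ := Finset.sum_le_sum fun z _ => Finset.sum_le_sum fun y _ =>
          mul_le_mul_of_nonneg_left (integral_abs_mul_integral_abs_le hμ2 hM z y) (mul_nonneg (ha0 z) (hb0 y))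
      _ = M₂ * (∑ z, a z) * (∑ z, b z) := hsum.symm
  calc |∫ ω, (F ω - f0) * (G ω - g0) ∂μ - (∫ ω, (F ω - f0) ∂μ) * (∫ ω, (G ω - g0) ∂μ)|
      ≤ |∫ ω, (F ω - f0) * (G ω - g0) ∂μ| + |(∫ ω, (F ω - f0) ∂μ) * (∫ ω, (G ω - g0) ∂μ)| := abs_sub _ _
    _ ≤ M₂ * (∑ z, a z) * (∑ z, b z) + M₂ * (∑ z, a z) * (∑ z, b z) := add_le_add h1 h2
    _ = 2 * M₂ * (∑ z, a z) * (∑ z, b z) := by ring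

end Measure

/-! ## §4. Toy instance (kernel) -/

/-- Toy: on `Fin 1 → ℝ` the coordinate `F(ω) = ω 0` has coordinate-Lipschitz vector `a = 1`. -/
example (z : Fin 1) (ω : Fin 1 → ℝ) (s t : ℝ) :
    |(fun ω : Fin 1 → ℝ => ω 0) (update ω z s) - (fun ω : Fin 1 → ℝ => ω 0) (update ω z t)| ≤ (fun _ => (1 : ℝ)) z * |s - t| := by
  have hz : z = 0 := Subsingleton.elim _ _
  subst hz
  simp

end Summit.QuantumFields.BalabanUV.T4Continuum.NE7b.SupCoordinateLipschitzClass

end
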